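import Summits.Parity.BatemanHorn.Theses.AlmostPrimeZeros
import Summits.Parity.BatemanHorn.Theorems.AlmostPrimeZerosSystemMertensCounting
import Literature.NumberTheory.Sieve.PolynomialCongruencesMeanValues
import Literature.NumberTheory.Sieve.ParityWave0SchinzelBatemanHornProofs
import Literature.NumberTheory.LFunctions.MertensFormula
import HarnessLib

/-!
# Route `AlmostPrimeZeros`, support item `SystemMertens` (stmt-Parity-11293): the proof

`Summit.Parity.BatemanHorn.Theses.AlmostPrimeZeros.SystemMertens`: for every Bateman–Horn system
`f = (f₁, …, f_k)` there is `C_f` with `|(x+1)⁻¹ Σ_{0 ≤ n ≤ x} s_f(n) − k log log x| ≤ C_f` for all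
`x ≥ 2`, where `s_f(n) = Σᵢ Σ_{p^v ∥ fᵢ(n)} min(v, 2)` (values `fᵢ(n) ≤ 0` contribute `0`).

Proof (Mertens along each `fᵢ`, elementary given the tree facts).  It suffices to treat ONE
irreducible `g ∈ ℤ[X]` of degree `d ≥ 1` with positive leading coefficient
(`abs_sum_capped_div_sub_loglog_le`) and to sum over `i` (triangle inequality).  Write
`G(n) = g(n)⁺`, `ρ(q) = #{n mod q : q ∣ g(n)}` (`Literature.NumberTheory.Sieve.polyRootCountMod ![g] q`),
`Y = x + 1`, `H = Σ_j |coeff_j g|`.  By the counting file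
(`Summits/Parity/BatemanHorn/Theorems/AlmostPrimeZerosSystemMertensCounting.lean`),
`s(G n) = ω(G n) + #{p : p² ∣ G n}` splits at `p ≤ x`/`p ≥ Y` and `p² ≤ x`/`p² ≥ Y`; since
`G(n) ≤ H·Y^d`, at most `d + H` primes `p ≥ Y` and at most `d + H` prime squares `p² ≥ Y` divide
`G(n) ≠ 0`.  Exchanging the summations, `Σ_{n ≤ x} s(G n)` lies between
`Σ_{p ≤ x} #{n ≤ x : p ∣ G n ≠ 0}` and the same plus `Σ_{p² ≤ x} #{n ≤ x : p² ∣ G n ≠ 0} + 2(d+H)Y`.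
By periodicity `#{n < Y : q ∣ g(n)} ∈ [ρ(q)⌊Y/q⌋, ρ(q)(⌊Y/q⌋ + 1)]`, and `q ∣ G n ≠ 0 ⇒ q ∣ g(n)`,
conversely up to the `n₀` values with `g(n) ≤ 0`.  With `ρ(p) ≤ d` and the uniform Hensel–Nagell
bound `ρ(p²) ≤ d·M` (`Literature.NumberTheory.Sieve.exists_rootCount_primePow_le`) and
`Σ_p p⁻² ≤ 1`, this gives `|Y⁻¹ Σ_{n ≤ x} s(G n) − Σ_{p ≤ x} ρ(p)/p| ≤ 3d + 2dM + 2H + n₀`.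
Finally `Σ_{p ≤ x} ρ(p)/p = log log x + O(1)`: the upper half is the tree's
`Literature.NumberTheory.Sieve.exists_sum_primesLE_rootCount_div_le`, the lower half
(`exists_loglog_sub_le_sum_rootCount_div`) combines the convergence of `Σ_p (ρ(p) − 1)/p`
(`Literature.NumberTheory.Sieve.BatemanHorn1962_rootCountSeries_holds`, Bateman–Horn 1962 p. 364,
prime ideal theorem) with Mertens' second theorem with rate
(`Literature.NumberTheory.LFunctions.Mertens.abs_primeRecipSum_sub_le`).

References: H. Halberstam, H.-E. Richert, *Sieve Methods* (1974), Ch. 1 and Lemma 5.4;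
G. Tenenbaum, *Introduction to analytic and probabilistic number theory* (2015), I.1 and III.3;
P. T. Bateman, R. A. Horn, Math. Comp. 16 (1962), p. 364.
-/

namespace Summit.Parity.BatemanHorn.Theorems.AlmostPrimeZeros.SystemMertens

open Finset Polynomial Filter
open Literature.NumberTheory.Sieve

/-! ### From `q ∣ g(n)⁺ ≠ 0` to `q ∣ g(n)` and back -/

/-- `#{n < N : q ∣ g(n)⁺ ≠ 0} ≤ #{n < N : q ∣ g(n)}`. [folklore] -/
theorem card_filter_dvd_toNat_le (g : ℤ[X]) (q N : ℕ) :
    #((range N).filter fun n : ℕ => q ∣ (g.eval (n : ℤ)).toNat ∧ (g.eval (n : ℤ)).toNat ≠ 0) ≤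
      #((range N).filter fun n : ℕ => (q : ℤ) ∣ g.eval (n : ℤ)) :=
  card_le_card fun n hn => by
    rw [mem_filter] at hn ⊢
    exact ⟨hn.1, (dvd_toNat_and_ne_zero_iff.1 hn.2).2⟩

/-- If `g(n) > 0` for `n ≥ n₀` then `#{n < N : q ∣ g(n)} ≤ #{n < N : q ∣ g(n)⁺ ≠ 0} + n₀`.
[folklore] -/
theorem card_filter_dvd_eval_le_add (g : ℤ[X]) (q N : ℕ) {n₀ : ℕ}
    (hpos : ∀ n : ℕ, n₀ ≤ n → 0 < g.eval (n : ℤ)) :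
    #((range N).filter fun n : ℕ => (q : ℤ) ∣ g.eval (n : ℤ)) ≤
      #((range N).filter fun n : ℕ => q ∣ (g.eval (n : ℤ)).toNat ∧ (g.eval (n : ℤ)).toNat ≠ 0) + n₀ := by
  calc #((range N).filter fun n : ℕ => (q : ℤ) ∣ g.eval (n : ℤ))
      ≤ #(((range N).filter fun n : ℕ => q ∣ (g.eval (n : ℤ)).toNat ∧ (g.eval (n : ℤ)).toNat ≠ 0) ∪
          range n₀) := by
        refine card_le_card fun n hn => ?_
        rw [mem_filter] at hn
        rw [mem_union, mem_filter]
        by_cases h : n₀ ≤ n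
        · exact Or.inl ⟨hn.1, dvd_toNat_and_ne_zero_iff.2 ⟨hpos n h, hn.2⟩⟩
        · exact Or.inr (mem_range.2 (not_le.1 h))
    _ ≤ #((range N).filter fun n : ℕ => q ∣ (g.eval (n : ℤ)).toNat ∧ (g.eval (n : ℤ)).toNat ≠ 0) +
          #(range n₀) := card_union_le _ _
    _ = _ := by rw [card_range]

/-! ### Mertens for `ρ_g` from below -/

/-- **`Σ_{p ≤ x} ρ_g(p)/p ≥ log log x − C`** for `g` irreducible of positive degree with positive
leading coefficient: `Σ_p (ρ_g(p) − 1)/p` converges (Bateman–Horn 1962, p. 364: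
`BatemanHorn1962_rootCountSeries_holds`) and `Σ_{p ≤ x} 1/p ≥ log log x + B₁ − 8/log x`
(Mertens, `Mertens.abs_primeRecipSum_sub_le`). [folklore] -/
theorem exists_loglog_sub_le_sum_rootCount_div {g : ℤ[X]} (hirr : Irreducible g)
    (hdeg : 0 < g.natDegree) (hlc : 0 < g.leadingCoeff) :
    ∃ C : ℝ, ∀ x : ℕ, 2 ≤ x →
      Real.log (Real.log x) - C ≤ ∑ p ∈ Nat.primesLE x, (polyRootCountMod ![g] p : ℝ) / p := by
  obtain ⟨A, hA⟩ := BatemanHorn1962_rootCountSeries_holds g hirr hdeg hlc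
  obtain ⟨m, hm⟩ := hA.bddBelow_range
  refine ⟨12 - m - Literature.NumberTheory.LFunctions.Mertens.meisselMertens, fun x hx => ?_⟩
  have h1 : m ≤ ∑ p ∈ Nat.primesLE x, ((polyRootCountMod ![g] p : ℝ) - 1) / p := hm ⟨x, rfl⟩
  have hx' : (2 : ℝ) ≤ x := by exact_mod_cast hx
  have h2 := Literature.NumberTheory.LFunctions.Mertens.abs_primeRecipSum_sub_le hx'
  rw [Literature.NumberTheory.LFunctions.Mertens.primeRecipSum, Nat.floor_natCast] at h2
  have hlog2 := Real.log_two_gt_d9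
  have hlogx : Real.log 2 ≤ Real.log x := Real.log_le_log two_pos hx'
  have h3 : 8 / Real.log x ≤ 12 := by
    rw [div_le_iff₀ (by linarith)]
    linarith
  have h4 : ∑ p ∈ Nat.primesLE x, (polyRootCountMod ![g] p : ℝ) / p =
      ∑ p ∈ Nat.primesLE x, ((polyRootCountMod ![g] p : ℝ) - 1) / p +
        ∑ p ∈ Nat.primesLE x, (p : ℝ)⁻¹ := by
    rw [← sum_add_distrib]
    refine sum_congr rfl fun p hp => ?_
    have hp0 : (p : ℝ) ≠ 0 := by exact_mod_cast (Nat.mem_primesLE.1 hp).2.ne_zero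
    field_simp
    ring
  rw [h4]
  have h5 := (abs_le.1 (h2.trans h3)).1
  linarith

/-! ### One irreducible polynomial -/

/-- A lower bound for natural division cast to `ℝ`: `a/b − 1 ≤ ⌊a/b⌋`. [folklore] -/
theorem div_sub_one_le_cast_div (a : ℕ) {b : ℕ} (hb : 0 < b) :
    (a : ℝ) / b - 1 ≤ ((a / b : ℕ) : ℝ) := by
  have h : a < a / b * b + b := Nat.lt_div_mul_add hb
  have hb' : (0 : ℝ) < b := by exact_mod_cast hb
  have h' : (a : ℝ) < ((a / b : ℕ) : ℝ) * b + b := by exact_mod_cast h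
  rw [div_sub_one hb'.ne', div_le_iff₀ hb']
  linarith

/-- `Σ_{p ≤ x prime} 1/p² ≤ 1` (`≤ Σ_{2 ≤ i ≤ x} 1/i² ≤ 1 − 1/x`). [folklore] -/
theorem sum_primesLE_inv_sq_le_one (x : ℕ) :
    ∑ p ∈ (Nat.primesLE x).filter (fun p => p ^ 2 ≤ x), ((p : ℝ) ^ 2)⁻¹ ≤ 1 := by
  rcases Nat.eq_zero_or_pos x with rfl | hx
  · simp [Nat.primesLE, Nat.primesBelow, Finset.filter_singleton, Nat.not_prime_zero]
  calc ∑ p ∈ (Nat.primesLE x).filter (fun p => p ^ 2 ≤ x), ((p : ℝ) ^ 2)⁻¹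
      ≤ ∑ i ∈ Ioc 1 x, ((i : ℝ) ^ 2)⁻¹ := by
        refine sum_le_sum_of_subset_of_nonneg (fun p hp => ?_) fun i _ _ => by positivity
        simp only [mem_filter, Nat.mem_primesLE] at hp
        rw [mem_Ioc]
        exact ⟨hp.1.2.one_lt, hp.1.1⟩
    _ ≤ (1 : ℝ)⁻¹ - (x : ℝ)⁻¹ := by exact_mod_cast sum_Ioc_inv_sq_le_sub one_ne_zero hx
    _ ≤ 1 := by
        rw [inv_one, sub_le_self_iff]
        positivity

/-- **Upper count** (in `ℕ`): for `x ≥ 1`,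
`Σ_{n ≤ x} s(g(n)⁺) ≤ Σ_{p ≤ x} ρ(p)(⌊Y/p⌋ + 1) + Σ_{p² ≤ x} ρ(p²)(⌊Y/p²⌋ + 1) + 2(d + H)Y`,
`Y = x + 1`, `H = Σ_j |coeff_j g|`. [folklore] -/
theorem sum_capped_le_rootCount (g : ℤ[X]) {x : ℕ} (hx : 1 ≤ x) :
    ∑ n ∈ range (x + 1), ((g.eval (n : ℤ)).toNat.factorization.sum fun _ v => min v 2) ≤
      ∑ p ∈ Nat.primesLE x, polyRootCountMod ![g] p * ((x + 1) / p + 1) +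
        ∑ p ∈ (Nat.primesLE x).filter (fun p => p ^ 2 ≤ x),
          polyRootCountMod ![g] (p ^ 2) * ((x + 1) / p ^ 2 + 1) +
        2 * (g.natDegree + ∑ j ∈ range (g.natDegree + 1), (g.coeff j).natAbs) * (x + 1) := by
  have hG : ∀ n ∈ range (x + 1), (g.eval (n : ℤ)).toNat ≤
      (∑ j ∈ range (g.natDegree + 1), (g.coeff j).natAbs) * (x + 1) ^ g.natDegree :=
    fun n hn => toNat_eval_le g (Nat.lt_succ_iff.1 (mem_range.1 hn))
  refine (sum_capped_le (fun n => (g.eval (n : ℤ)).toNat) hx hG).trans ?_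
  gcongr with p hp p hp
  · have hp0 : 0 < p := (Nat.mem_primesLE.1 hp).2.pos
    exact (card_filter_dvd_toNat_le g p (x + 1)).trans (card_filter_range_dvd_eval_le g hp0 (x + 1))
  · have hp0 : 0 < p ^ 2 := pow_pos (Nat.mem_primesLE.1 (mem_filter.1 hp).1).2.pos 2
    exact (card_filter_dvd_toNat_le g (p ^ 2) (x + 1)).trans
      (card_filter_range_dvd_eval_le g hp0 (x + 1))

/-- **Lower count** (in `ℕ`): if `g(n) > 0` for `n ≥ n₀` then
`Σ_{p ≤ x} ρ(p)⌊Y/p⌋ ≤ Σ_{n ≤ x} s(g(n)⁺) + n₀·π(x)`, `Y = x + 1`. [folklore] -/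
theorem sum_rootCount_le_sum_capped (g : ℤ[X]) (x : ℕ) {n₀ : ℕ}
    (hpos : ∀ n : ℕ, n₀ ≤ n → 0 < g.eval (n : ℤ)) :
    ∑ p ∈ Nat.primesLE x, polyRootCountMod ![g] p * ((x + 1) / p) ≤
      ∑ n ∈ range (x + 1), ((g.eval (n : ℤ)).toNat.factorization.sum fun _ v => min v 2) +
        n₀ * #(Nat.primesLE x) := by
  have h1 := le_sum_capped (fun n => (g.eval (n : ℤ)).toNat) x
  have h2 : ∑ p ∈ Nat.primesLE x, polyRootCountMod ![g] p * ((x + 1) / p) ≤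
      ∑ p ∈ Nat.primesLE x,
        (#((range (x + 1)).filter fun n : ℕ =>
          p ∣ (g.eval (n : ℤ)).toNat ∧ (g.eval (n : ℤ)).toNat ≠ 0) + n₀) := by
    refine sum_le_sum fun p hp => ?_
    have hp0 : 0 < p := (Nat.mem_primesLE.1 hp).2.pos
    exact (le_card_filter_range_dvd_eval g hp0 (x + 1)).trans
      (card_filter_dvd_eval_le_add g p (x + 1) hpos)
  rw [sum_add_distrib, sum_const, smul_eq_mul, mul_comm] at h2
  omega

/-- **Mertens along an irreducible polynomial for the capped statistic.**  For `g ∈ ℤ[X]`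
irreducible of positive degree with positive leading coefficient there is `C` with
`|(x+1)⁻¹ Σ_{0 ≤ n ≤ x} s(g(n)⁺) − log log x| ≤ C` for all `x ≥ 2`,
`s(m) = Σ_{p^v ∥ m} min(v, 2)`. [folklore] -/
theorem abs_sum_capped_div_sub_loglog_le {g : ℤ[X]} (hirr : Irreducible g)
    (hdeg : 0 < g.natDegree) (hlc : 0 < g.leadingCoeff) :
    ∃ C : ℝ, ∀ x : ℕ, 2 ≤ x →
      |((∑ n ∈ range (x + 1), ((g.eval (n : ℤ)).toNat.factorization.sum fun _ v => min v 2) : ℕ) :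
          ℝ) / ((x : ℝ) + 1) - Real.log (Real.log x)| ≤ C := by
  obtain ⟨M, -, hM, hρd⟩ := exists_rootCount_primePow_le hirr hdeg
  obtain ⟨C₁, hC₁⟩ := exists_sum_primesLE_rootCount_div_le hirr hdeg
  obtain ⟨C₂, hC₂⟩ := exists_loglog_sub_le_sum_rootCount_div hirr hdeg hlc
  obtain ⟨n₀, hn₀⟩ := eventually_atTop.1 (eventually_eval_natCast_pos hdeg hlc)
  set d : ℕ := g.natDegree
  set H : ℕ := ∑ j ∈ range (g.natDegree + 1), (g.coeff j).natAbs
  refine ⟨max (C₁ + (3 * d + 2 * d * M + 2 * H)) (C₂ + (d + n₀)), fun x hx => ?_⟩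
  -- abbreviations
  set Y : ℝ := (x : ℝ) + 1 with hY
  set S : ℝ := ∑ p ∈ Nat.primesLE x, (polyRootCountMod ![g] p : ℝ) / p
  set T : ℕ := ∑ n ∈ range (x + 1), ((g.eval (n : ℤ)).toNat.factorization.sum fun _ v => min v 2)
  have hY0 : 0 < Y := by positivity
  have hYnat : ((x + 1 : ℕ) : ℝ) = Y := by push_cast; rfl
  have hP : (#(Nat.primesLE x) : ℝ) ≤ Y := by
    rw [← hYnat]
    exact_mod_cast (card_le_card (filter_subset _ _)).trans (card_range (x + 1)).le
  -- upper bound: T ≤ Y S + (3d + 2dM + 2H) Y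
  have hupper : (T : ℝ) ≤ Y * S + (3 * d + 2 * d * M + 2 * H) * Y := by
    have h0 := sum_capped_le_rootCount g (by omega : 1 ≤ x)
    have h0' : (T : ℝ) ≤ ∑ p ∈ Nat.primesLE x, (polyRootCountMod ![g] p : ℝ) * (((x + 1) / p : ℕ) + 1) +
        ∑ p ∈ (Nat.primesLE x).filter (fun p => p ^ 2 ≤ x),
          (polyRootCountMod ![g] (p ^ 2) : ℝ) * (((x + 1) / p ^ 2 : ℕ) + 1) +
        2 * (d + H) * Y := by
      rw [← hYnat]
      exact_mod_cast h0
    have h1 : ∑ p ∈ Nat.primesLE x, (polyRootCountMod ![g] p : ℝ) * (((x + 1) / p : ℕ) + 1) ≤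
        Y * S + d * Y := by
      calc ∑ p ∈ Nat.primesLE x, (polyRootCountMod ![g] p : ℝ) * (((x + 1) / p : ℕ) + 1)
          ≤ ∑ p ∈ Nat.primesLE x, (Y * ((polyRootCountMod ![g] p : ℝ) / p) + d) := by
            refine sum_le_sum fun p hp => ?_
            have hp0 : (0 : ℝ) < p := by exact_mod_cast (Nat.mem_primesLE.1 hp).2.pos
            have hdiv : (((x + 1) / p : ℕ) : ℝ) ≤ Y / p := by
              rw [← hYnat]; exact Nat.cast_div_le
            have hρ0 : (0 : ℝ) ≤ polyRootCountMod ![g] p := Nat.cast_nonneg _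
            calc (polyRootCountMod ![g] p : ℝ) * (((x + 1) / p : ℕ) + 1)
                ≤ (polyRootCountMod ![g] p : ℝ) * (Y / p + 1) := by gcongr
              _ = Y * ((polyRootCountMod ![g] p : ℝ) / p) + polyRootCountMod ![g] p := by
                  field_simp
              _ ≤ Y * ((polyRootCountMod ![g] p : ℝ) / p) + d := by
                  gcongr; exact hρd p (Nat.mem_primesLE.1 hp).2
        _ = Y * S + d * #(Nat.primesLE x) := by
            rw [sum_add_distrib, ← mul_sum, sum_const, nsmul_eq_mul, mul_comm (d : ℝ)]
        _ ≤ Y * S + d * Y := by gcongr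
    have h2 : ∑ p ∈ (Nat.primesLE x).filter (fun p => p ^ 2 ≤ x),
          (polyRootCountMod ![g] (p ^ 2) : ℝ) * (((x + 1) / p ^ 2 : ℕ) + 1) ≤ 2 * d * M * Y := by
      calc ∑ p ∈ (Nat.primesLE x).filter (fun p => p ^ 2 ≤ x),
            (polyRootCountMod ![g] (p ^ 2) : ℝ) * (((x + 1) / p ^ 2 : ℕ) + 1)
          ≤ ∑ p ∈ (Nat.primesLE x).filter (fun p => p ^ 2 ≤ x),
              2 * d * M * Y * ((p : ℝ) ^ 2)⁻¹ := by
            refine sum_le_sum fun p hp => ?_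
            obtain ⟨hp1, hp2⟩ := mem_filter.1 hp
            have hpp := (Nat.mem_primesLE.1 hp1).2
            have hpR : (0 : ℝ) < p := by exact_mod_cast hpp.pos
            have hp0 : (0 : ℝ) < (p : ℝ) ^ 2 := by positivity
            have hsq : ((p : ℝ) ^ 2) ≤ x := by exact_mod_cast hp2
            have hdiv : (((x + 1) / p ^ 2 : ℕ) : ℝ) ≤ Y / (p : ℝ) ^ 2 := by
              have := Nat.cast_div_le (m := x + 1) (n := p ^ 2) (α := ℝ)
              push_cast at this
              exact this
            have hone : (1 : ℝ) ≤ Y / (p : ℝ) ^ 2 := by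
              rw [le_div_iff₀ hp0, hY]; linarith
            have hρ : (polyRootCountMod ![g] (p ^ 2) : ℝ) ≤ d * M := by exact_mod_cast hM p hpp 2
            have hρ0 : (0 : ℝ) ≤ polyRootCountMod ![g] (p ^ 2) := Nat.cast_nonneg _
            calc (polyRootCountMod ![g] (p ^ 2) : ℝ) * (((x + 1) / p ^ 2 : ℕ) + 1)
                ≤ (d * M : ℝ) * (Y / (p : ℝ) ^ 2 + Y / (p : ℝ) ^ 2) := by gcongr
              _ = 2 * d * M * Y * ((p : ℝ) ^ 2)⁻¹ := by ring
        _ = 2 * d * M * Y * ∑ p ∈ (Nat.primesLE x).filter (fun p => p ^ 2 ≤ x), ((p : ℝ) ^ 2)⁻¹ := by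
            rw [mul_sum]
        _ ≤ 2 * d * M * Y * 1 := by gcongr; exact sum_primesLE_inv_sq_le_one x
        _ = 2 * d * M * Y := mul_one _
    nlinarith [h0', h1, h2]
  -- lower bound: Y S − (d + n₀) Y ≤ T
  have hlower : Y * S - (d + n₀) * Y ≤ T := by
    have h0 := sum_rootCount_le_sum_capped g x hn₀
    have h0' : ∑ p ∈ Nat.primesLE x, (polyRootCountMod ![g] p : ℝ) * (((x + 1) / p : ℕ) : ℝ) ≤
        T + n₀ * #(Nat.primesLE x) := by exact_mod_cast h0
    have h1 : Y * S - d * #(Nat.primesLE x) ≤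
        ∑ p ∈ Nat.primesLE x, (polyRootCountMod ![g] p : ℝ) * (((x + 1) / p : ℕ) : ℝ) := by
      calc Y * S - d * #(Nat.primesLE x)
          = ∑ p ∈ Nat.primesLE x, (Y * ((polyRootCountMod ![g] p : ℝ) / p) - d) := by
            rw [sum_sub_distrib, ← mul_sum, sum_const, nsmul_eq_mul, mul_comm (d : ℝ)]
        _ ≤ ∑ p ∈ Nat.primesLE x, (polyRootCountMod ![g] p : ℝ) * (((x + 1) / p : ℕ) : ℝ) := by
            refine sum_le_sum fun p hp => ?_
            have hp0 : 0 < p := (Nat.mem_primesLE.1 hp).2.pos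
            have hp0' : (0 : ℝ) < p := by exact_mod_cast hp0
            have hdiv : Y / p - 1 ≤ (((x + 1) / p : ℕ) : ℝ) := by
              rw [← hYnat]; exact div_sub_one_le_cast_div (x + 1) hp0
            have hρ0 : (0 : ℝ) ≤ polyRootCountMod ![g] p := Nat.cast_nonneg _
            calc Y * ((polyRootCountMod ![g] p : ℝ) / p) - d
                ≤ Y * ((polyRootCountMod ![g] p : ℝ) / p) - polyRootCountMod ![g] p := by
                  gcongr; exact hρd p (Nat.mem_primesLE.1 hp).2
              _ = (polyRootCountMod ![g] p : ℝ) * (Y / p - 1) := by field_simp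
              _ ≤ (polyRootCountMod ![g] p : ℝ) * (((x + 1) / p : ℕ) : ℝ) := by gcongr
    have hn0 : (0 : ℝ) ≤ n₀ := Nat.cast_nonneg _
    have hd0 : (0 : ℝ) ≤ d := Nat.cast_nonneg _
    nlinarith [h0', h1, hP]
  -- conclusion
  have hSup : S ≤ Real.log (Real.log x) + C₁ := hC₁ x hx
  have hSlo : Real.log (Real.log x) - C₂ ≤ S := hC₂ x hx
  rw [abs_sub_le_iff]
  constructor
  · refine le_trans ?_ (le_max_left _ _)
    rw [sub_le_iff_le_add, div_le_iff₀ hY0]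
    nlinarith [hupper, hSup]
  · refine le_trans ?_ (le_max_right _ _)
    rw [sub_le_iff_le_add, ← sub_le_iff_le_add', le_div_iff₀ hY0]
    nlinarith [hlower, hSlo]

end Summit.Parity.BatemanHorn.Theorems.AlmostPrimeZeros.SystemMertens

/-! ### The system -/

namespace Summit.Parity.BatemanHorn.Theorems

open Finset Polynomial
open Summit.Parity.BatemanHorn.Theorems.AlmostPrimeZeros.SystemMertens

/-- **`SystemMertens`** (item stmt-Parity-11293 of route `AlmostPrimeZeros`): for every
Bateman–Horn system `f = (f₁, …, f_k)` there is `C` with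
`|(x+1)⁻¹ Σ_{0 ≤ n ≤ x} s_f(n) − k·log log x| ≤ C` for all `x ≥ 2`,
`s_f(n) = Σᵢ Σ_{p^v ∥ fᵢ(n)} min(v, 2)` — the mean of `s_f` is `k log log x + O(1)` (Mertens along
each `fᵢ`, `abs_sum_capped_div_sub_loglog_le`, summed over `i`). [folklore] -/
theorem SystemMertens_proof : Summit.Parity.BatemanHorn.Theses.AlmostPrimeZeros.SystemMertens := by
  unfold Summit.Parity.BatemanHorn.Theses.AlmostPrimeZeros.SystemMertens
  intro k f hf
  choose C hC using fun i => abs_sum_capped_div_sub_loglog_le (hf.irreducible i)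
    (hf.natDegree_pos i) (hf.leadingCoeff_pos i)
  refine ⟨∑ i, C i, fun x hx => ?_⟩
  have key : ((∑ n ∈ range (x + 1), ∑ i,
        (((f i).eval (n : ℤ)).toNat.factorization.sum fun _ v => min v 2) : ℕ) : ℝ) / ((x : ℝ) + 1) -
        (k : ℝ) * Real.log (Real.log x) =
      ∑ i, ((((∑ n ∈ range (x + 1),
        (((f i).eval (n : ℤ)).toNat.factorization.sum fun _ v => min v 2) : ℕ) : ℝ) / ((x : ℝ) + 1) -
          Real.log (Real.log x))) := by
    rw [sum_comm]
    push_cast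
    rw [sum_div, sum_sub_distrib, sum_const, card_univ, Fintype.card_fin, nsmul_eq_mul]
  rw [key]
  exact (abs_sum_le_sum_abs _ _).trans (sum_le_sum fun i _ => hC i x hx)

end Summit.Parity.BatemanHorn.Theorems
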